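import Summits.BirchSwinnertonDyer.BirchSwinnertonDyer.Theorems.KimAtThreeFineKatoLevelCompatTwist
import Literature.NumberTheory.AdelicBaseChange.PadicTensorCompletionGaloisProofs
import HarnessLib

/-!
# `ZetaBody` (C3a)/(C3b) for a value datum DEFINED through ONE completion: Galois equivariance of
# `Λ(y)_w := σ_w⁻¹ (exp*_{w₀} (loc^{tower}_{w₀} (H1toInt (g_w · y))))` from the `D`-equivariance of
# `exp*_{w₀} ∘ loc_{w₀}` alone (crux `KatoKuriharaPortThreeShared`, stmt-BirchSwinnertonDyer-19560;
# cell `bsd-addord`, seat w2-acc5 gen 5; route W2 `KimAtThreeKolyvagin`; `--supports 19560`, helper)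

HONEST FRAMING.  TOOL theorems only (no definition, no named fact, no `sorry`); every `p`, `k`, `r`;
closes nothing; nothing is booked; BSD is not proved by any of this.

THE POINT.  Kato's dual-exponential value datum is `Λ = exp* ∘ loc_p` on the semi-local cohomology
`H¹(ℚ(ζ_m) ⊗ ℚ_p, T) = ⊕_{w ∣ p} H¹(L_w, T)`, with values in `ℚ_p ⊗ ℚ(ζ_m) ≅ ∏_w L_w` (w2-acc4's `Ψ`,
Cassels–Fröhlich II §10 (10.2)).  `Kato2004.ZetaBody` carries two datum axioms about `Λ`, readings of
§9.4 with OWN attribution — (C3a) `Gal(ℚ(μ_m)/ℚ)`-equivariance `Λ(σ · y) = (1 ⊗ σ̃) Λ(y)`,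
`σ̃ = sigma m (χ_m σ)`, and (C3b) locality at `p` — which for a DEFINED `Λ` are THEOREMS to be
proved, not clauses to be cited.  In the tree every tower localisation `loc^{tower}_w : H¹(U, T) →
H¹(Γ_{L_w}, T)` reads ONE place `w₀* = 𝔓₀ ∩ ℚ(μ_m)` (`LevelFieldLocalization` §4); the `g` places above
`p` are reached by twisting, `loc^{tower} ∘ conjMap g_w` (`KimAtThreeFineKatoLevelCompatTwist`,
`…LevelTwistChoice`, `…PerFactorDefinedTwist`).  The cheapest honest definition therefore uses ONE
completion `L_{w₀}` and ONE additive `F = exp*_{w₀} ∘ loc^{tower}_{w₀} ∘ H1toInt : H¹(U, T) → L_{w₀}`,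
a twist family `g : {w ∣ p} → Γ_ℚ` with `g̃_w • w = w₀` (`g̃ = sigma m ∘ χ_m`, acting on places by
`Literature.NumberTheory.Automorphic.GaloisActionPlaces`), and TRANSPORTS the values:
**(DEF₀)** `Ψ(Λ y)_w = (g̃_w)_*⁻¹ (F (g_w · y))`, `(g̃_w)_*⁻¹ = galAdicCompletionMap g̃_w⁻¹ : L_{w₀} → L_w`
(Cassels–Fröhlich VII §1.1).  THIS FILE proves, for such a `Λ`:

* §1 `conjMap_eq_map_sigma_of_singleField` — **(C3a) VERBATIM** from (DEF₀) and the ONE natural property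
  **(GAL₀)** `F (δ · Y) = (δ̃)_* (F Y)` for every `δ ∈ Γ_ℚ` whose image `δ̃` fixes `w₀` (the
  decomposition group: `exp*_{w₀} ∘ loc_{w₀}` is `Gal(L_{w₀}/ℚ_p)`-equivariant — Kato §9.4 "`exp*` is a
  homomorphism of `ℚ_p[Gal(ℚ(ζ_m)/ℚ)]`-modules", read at one place).  Mechanism: by
  `PadicTensorCompletionGaloisProofs.padicTensor_map_galois` the action `1 ⊗ σ̃` PERMUTES the factors and
  transports values along `σ̃_*`; with `w' = σ̃ • w` the element `δ := g_{w'} σ g_w⁻¹` has `δ̃ • w₀ = w₀`,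
  `g_{w'} σ = δ g_w`, and the cocycle law `σ̃_* ∘ (g̃_w⁻¹)_* = (σ̃ g̃_w⁻¹)_* = (g̃_{w'}⁻¹)_* ∘ δ̃_*`
  (`galAdicCompletionMap_galAdicCompletionMap`) — NO commutativity of `Gal(ℚ(ζ_m)/ℚ)`, no surjectivity of
  `χ_m`, no hypothesis on `U` is used.
* §2 `eq_zero_of_forall_primesAbove_of_singleField` — **(C3b) VERBATIM** for
  `F := φ₀ ∘ loc^{tower}_{w₀} ∘ H1toInt` with `φ₀` additive (w2-acc5 g4
  `locTower_H1toInt_conjMap_eq_zero_of_forall_primesAbove`: the binder is `Γ_ℚ`-stable).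

So a supplier of `ZetaBody` for the defined `Λ` (the Kato-v2 bridge) owes, besides Kato's printed
clauses (C1)(C2)(C4)(C5), exactly (GAL₀) at one completion.  NOT here: `exp*`, (GAL₀) itself, the
COMPAT clause (sibling `KimAtThreeFineKatoPerFactorDefinedTwist` §1 with `σ := g_w` at `w₀`, then
`galAdicCompletionMap_algebraMap_adicCompletion`), any `p = 3` specific.

References: K. Kato, Astérisque 295 (2004) §9.4, Thm. 9.7 [Kato2004Asterisque]; J. W. S. Cassels,
A. Fröhlich, *Algebraic Number Theory* (1967) Ch. II §10 (10.2), Ch. VII §1.1 [CasselsFrohlichANT1967];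
J.-P. Serre, *Local Fields* (1979) VII §5 [SerreLocalFields1979]; K. Rubin, *Euler Systems* (2000)
Ch. III §2.1 [Rubin2000]; w2-acc5 HOME STATUS 2026-08-27 ≈05:45Z (finding) and gen-4 PRECISION 05:00Z.
-/

noncomputable section

-- the cell's Theorems namespace `Summit.BirchSwinnertonDyer.BirchSwinnertonDyer.…` repeats the summit name by design (D-0017)
set_option linter.dupNamespace false

open scoped Classical NumberField ContRepresentation TensorProduct Pointwise
open Field NumberField IsDedekindDomain
open WeierstrassCurve Literature.NumberTheory.EllipticCurves Literature.NumberTheory.GaloisRepresentations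
  Literature.NumberTheory.GaloisRepresentations.DiscreteGaloisModule
  Literature.NumberTheory.EllipticCurves.Kato2004.EulerSystemValues
open Literature.NumberTheory.AdelicBaseChange Literature.NumberTheory.Automorphic
open Summit.BirchSwinnertonDyer.Rank1Residual.GaloisImage
open Summit.BirchSwinnertonDyer.BirchSwinnertonDyer.Theorems.KimAtThreeFineKatoLevelCompatDef
open Summit.BirchSwinnertonDyer.BirchSwinnertonDyer.Theorems.KimAtThreeFineKatoLevelCompatTwist

namespace Summit.BirchSwinnertonDyer.BirchSwinnertonDyer.Theorems.KimAtThreeFineKatoValueEquivariance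

variable (W : WeierstrassCurve ℚ) [W.IsElliptic] (p : ℕ) [hp : Fact p.Prime]
  [ContinuousSMul ℤ_[p] (W.tateModule p)] (k : ℕ) (r : Finset (HeightOneSpectrum (𝓞 ℚ)))

/-! ## §1. (C3a) for the single-completion definition -/

set_option backward.isDefEq.respectTransparency false in
/-- **`ZetaBody` (C3a) for a value datum defined through ONE completion.**  Let `m = cycLevel p k r`,
`L = ℚ(ζ_m)`, `U = cycSubgroup p k r`, `Ψ : ℚ_p ⊗ L ≃ ∏_{w ∣ p} L_w` with the pure-tensor formula, `w₀`
a place of `L` above `p`, `F : H¹(U, T_pW) →+ L_{w₀}` additive (intended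
`exp*_{w₀} ∘ loc^{tower}_{w₀} ∘ H1toInt`), `g : {w ∣ p} → Γ_ℚ` with `g̃_w • w = w₀`
(`g̃ = sigma m ∘ χ_m`).  If (DEF₀) `Ψ(Λ y)_w = (g̃_w⁻¹)_* (F (g_w · y))` and (GAL₀)
`F (δ · Y) = δ̃_* (F Y)` whenever `δ̃ • w₀ = w₀`, then **`Λ (σ · y) = (1 ⊗ σ̃) Λ(y)`** for all
`σ ∈ Γ_ℚ`, `y ∈ H¹(U, T_pW)` — the (C3a) clause of `Kato2004.ZetaBody` at the level `(k, r)`, verbatim.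
[cite: Kato2004Asterisque, §9.4 (p. 188)] [cite: CasselsFrohlichANT1967, Ch. VII §1.1] -/
theorem conjMap_eq_map_sigma_of_singleField
    (Λ : H1 (tateRep W p) (cycSubgroup p k r) →ₗ[ℤ_[p]] ℚ_[p] ⊗[ℚ] CyclotomicField (cycLevel p k r) ℚ)
    (Ψ : ℚ_[p] ⊗[ℚ] CyclotomicField (cycLevel p k r) ℚ ≃ₐ[ℚ]
      (Π w : ((Rat.HeightOneSpectrum.primesEquiv (R := 𝓞 ℚ)).symm ⟨p, Fact.out⟩).Extension
        (𝓞 (CyclotomicField (cycLevel p k r) ℚ)), w.1.adicCompletion (CyclotomicField (cycLevel p k r) ℚ)))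
    (hΨ : ∀ (s : ℚ_[p]) (x : CyclotomicField (cycLevel p k r) ℚ)
      (w : ((Rat.HeightOneSpectrum.primesEquiv (R := 𝓞 ℚ)).symm ⟨p, Fact.out⟩).Extension
        (𝓞 (CyclotomicField (cycLevel p k r) ℚ))),
      Ψ (s ⊗ₜ[ℚ] x) w = algebraMap (CyclotomicField (cycLevel p k r) ℚ)
          (w.1.adicCompletion (CyclotomicField (cycLevel p k r) ℚ)) x *
        algebraMap (((Rat.HeightOneSpectrum.primesEquiv (R := 𝓞 ℚ)).symm ⟨p, Fact.out⟩).adicCompletion ℚ)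
          (w.1.adicCompletion (CyclotomicField (cycLevel p k r) ℚ)) (Padic.adicCompletionEquiv (𝓞 ℚ) ⟨p, Fact.out⟩ s))
    (w₀ : ((Rat.HeightOneSpectrum.primesEquiv (R := 𝓞 ℚ)).symm ⟨p, Fact.out⟩).Extension
      (𝓞 (CyclotomicField (cycLevel p k r) ℚ)))
    (F : H1 (tateRep W p) (cycSubgroup p k r) →+ w₀.1.adicCompletion (CyclotomicField (cycLevel p k r) ℚ))
    (g : ((Rat.HeightOneSpectrum.primesEquiv (R := 𝓞 ℚ)).symm ⟨p, Fact.out⟩).Extension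
      (𝓞 (CyclotomicField (cycLevel p k r) ℚ)) → absoluteGaloisGroup ℚ)
    (hg : ∀ w, sigma (cycLevel p k r) (modNCyclotomicCharacter ℚ (cycLevel p k r) (g w)) • w.1 = w₀.1)
    (hdef : ∀ w (y : H1 (tateRep W p) (cycSubgroup p k r)),
      Ψ (Λ y) w = galAdicCompletionMap
        (sigma (cycLevel p k r) (modNCyclotomicCharacter ℚ (cycLevel p k r) (g w)))⁻¹
        (inv_smul_eq_of_smul_eq (hg w))
        (F (conjMap (tateRep W p).toTopRep (cycSubgroup p k r) (g w) 1 y)))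
    (hgal : ∀ (δ : absoluteGaloisGroup ℚ)
      (hδ : sigma (cycLevel p k r) (modNCyclotomicCharacter ℚ (cycLevel p k r) δ) • w₀.1 = w₀.1)
      (Y : H1 (tateRep W p) (cycSubgroup p k r)),
      F (conjMap (tateRep W p).toTopRep (cycSubgroup p k r) δ 1 Y) =
        galAdicCompletionMap (sigma (cycLevel p k r) (modNCyclotomicCharacter ℚ (cycLevel p k r) δ)) hδ (F Y))
    (σ : absoluteGaloisGroup ℚ) (y : H1 (tateRep W p) (cycSubgroup p k r)) :
    Λ (conjMap (tateRep W p).toTopRep (cycSubgroup p k r) σ 1 y) =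
      Algebra.TensorProduct.map (AlgHom.id ℚ ℚ_[p])
        (sigma (cycLevel p k r) (modNCyclotomicCharacter ℚ (cycLevel p k r) σ) :
          CyclotomicField (cycLevel p k r) ℚ →ₐ[ℚ] CyclotomicField (cycLevel p k r) ℚ) (Λ y) := by
  -- `g̃ τ = sigma m (χ_m τ)` is a group homomorphism `Γ_ℚ → Aut(L/ℚ)`
  let gt : absoluteGaloisGroup ℚ →*
      (CyclotomicField (cycLevel p k r) ℚ ≃ₐ[ℚ] CyclotomicField (cycLevel p k r) ℚ) :=
    ((IsCyclotomicExtension.autEquivPow (CyclotomicField (cycLevel p k r) ℚ)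
      (Polynomial.cyclotomic.irreducible_rat (NeZero.pos (cycLevel p k r)))).symm.toMonoidHom).comp
      (modNCyclotomicCharacter ℚ (cycLevel p k r))
  have hgt : ∀ τ, gt τ = sigma (cycLevel p k r) (modNCyclotomicCharacter ℚ (cycLevel p k r) τ) :=
    fun _ => rfl
  apply Ψ.injective
  funext w'
  -- the factor `w` that `1 ⊗ σ̃` moves to `w'`
  let w : ((Rat.HeightOneSpectrum.primesEquiv (R := 𝓞 ℚ)).symm ⟨p, Fact.out⟩).Extension
      (𝓞 (CyclotomicField (cycLevel p k r) ℚ)) :=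
    ⟨(gt σ)⁻¹ • w'.1, by rw [HeightOneSpectrum.under_algEquiv_smul]; exact w'.2⟩
  have hw : gt σ • w.1 = w'.1 := smul_inv_smul (gt σ) w'.1
  have hP : Ψ (Algebra.TensorProduct.map (AlgHom.id ℚ ℚ_[p])
      (gt σ : CyclotomicField (cycLevel p k r) ℚ →ₐ[ℚ] CyclotomicField (cycLevel p k r) ℚ) (Λ y)) w' =
      galAdicCompletionMap (gt σ) hw (Ψ (Λ y) w) :=
    padicTensor_map_galois Ψ.toAlgHom hΨ (gt σ) w w' hw (Λ y)
  rw [← hgt σ, hP, hdef w' _, hdef w y, conjMap_conjMap]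
  -- `g_{w'} σ = δ g_w` with `δ̃` fixing `w₀`
  have h1 : (gt (g w))⁻¹ • w₀.1 = w.1 := inv_smul_eq_of_smul_eq (hg w)
  have h2 : gt (g w') • w'.1 = w₀.1 := hg w'
  have hδ : sigma (cycLevel p k r) (modNCyclotomicCharacter ℚ (cycLevel p k r) (g w' * σ * (g w)⁻¹)) •
      w₀.1 = w₀.1 := by
    rw [← hgt, map_mul, map_mul, map_inv, mul_smul, mul_smul, h1, hw, h2]
  have key : g w' * σ = (g w' * σ * (g w)⁻¹) * g w := by group
  have hgal' := hgal (g w' * σ * (g w)⁻¹) hδ (conjMap (tateRep W p).toTopRep (cycSubgroup p k r) (g w) 1 y)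
  rw [conjMap_conjMap, ← key] at hgal'
  rw [hgal', galAdicCompletionMap_galAdicCompletionMap, galAdicCompletionMap_galAdicCompletionMap]
  refine galAdicCompletionMap_congr_left _ ?_ _ _ _
  rw [← hgt, ← hgt, ← hgt, map_mul, map_mul, map_inv]
  group

/-! ## §2. (C3b) for the single-completion definition -/

set_option backward.isDefEq.respectTransparency false in
/-- **`ZetaBody` (C3b) for a value datum defined through ONE completion**: with
`F := φ₀ ∘ loc^{tower}_{w₀} ∘ H1toInt` (`φ₀` additive on `H¹(Γ_{L_{w₀}}, T_pW)`, tower action, into any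
`V`; the tower of `L_{w₀} ⊇ ℚ_{v_p}` landing in `U`) and (DEF₀) `Ψ(Λ y)_w = S_w (F (g_w · y))` for ANY additive
transports `S_w : V → L_w` (intended `(g̃_w⁻¹)_*`), a level class that dies on every
`U ⊓ D_𝔓`, `𝔓 ∣ p` (the (C3b) binder of `Kato2004.ZetaBody`, verbatim) has `Λ y = 0` — because the
binder is `Γ_ℚ`-stable and every twisted tower localisation of such a class vanishes
(`locTower_H1toInt_conjMap_eq_zero_of_forall_primesAbove`). [cite: Kato2004Asterisque, §9.4 (p. 188)] -/
theorem eq_zero_of_forall_primesAbove_of_singleField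
    (Λ : H1 (tateRep W p) (cycSubgroup p k r) →ₗ[ℤ_[p]] ℚ_[p] ⊗[ℚ] CyclotomicField (cycLevel p k r) ℚ)
    (Ψ : ℚ_[p] ⊗[ℚ] CyclotomicField (cycLevel p k r) ℚ ≃ₐ[ℚ]
      (Π w : ((Rat.HeightOneSpectrum.primesEquiv (R := 𝓞 ℚ)).symm ⟨p, Fact.out⟩).Extension
        (𝓞 (CyclotomicField (cycLevel p k r) ℚ)), w.1.adicCompletion (CyclotomicField (cycLevel p k r) ℚ)))
    (w₀ : ((Rat.HeightOneSpectrum.primesEquiv (R := 𝓞 ℚ)).symm ⟨p, Fact.out⟩).Extension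
      (𝓞 (CyclotomicField (cycLevel p k r) ℚ)))
    [Algebra (Place.Completion (Sum.inr ((Rat.HeightOneSpectrum.primesEquiv (R := 𝓞 ℚ)).symm ⟨p, Fact.out⟩)))
      (w₀.1.adicCompletion (CyclotomicField (cycLevel p k r) ℚ))]
    (hU : ∀ τ, absGaloisRestrictTower ℚ
      (Place.Completion (Sum.inr ((Rat.HeightOneSpectrum.primesEquiv (R := 𝓞 ℚ)).symm ⟨p, Fact.out⟩)))
      (w₀.1.adicCompletion (CyclotomicField (cycLevel p k r) ℚ)) τ ∈ cycSubgroup p k r)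
    {V : Type} [AddCommGroup V]
    (φ₀ : ((tateLocalRep W p (Sum.inr ((Rat.HeightOneSpectrum.primesEquiv (R := 𝓞 ℚ)).symm ⟨p, Fact.out⟩))).restrict
      (absGaloisRestrict (Place.Completion (Sum.inr ((Rat.HeightOneSpectrum.primesEquiv (R := 𝓞 ℚ)).symm ⟨p, Fact.out⟩)))
        (w₀.1.adicCompletion (CyclotomicField (cycLevel p k r) ℚ)))).cohomology 1 →+ V)
    (S : ∀ w : ((Rat.HeightOneSpectrum.primesEquiv (R := 𝓞 ℚ)).symm ⟨p, Fact.out⟩).Extension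
      (𝓞 (CyclotomicField (cycLevel p k r) ℚ)), V →+ w.1.adicCompletion (CyclotomicField (cycLevel p k r) ℚ))
    (g : ((Rat.HeightOneSpectrum.primesEquiv (R := 𝓞 ℚ)).symm ⟨p, Fact.out⟩).Extension
      (𝓞 (CyclotomicField (cycLevel p k r) ℚ)) → absoluteGaloisGroup ℚ)
    (hdef : ∀ w (y : H1 (tateRep W p) (cycSubgroup p k r)),
      Ψ (Λ y) w = S w (φ₀ (locTower ℚ
        (Place.Completion (Sum.inr ((Rat.HeightOneSpectrum.primesEquiv (R := 𝓞 ℚ)).symm ⟨p, Fact.out⟩)))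
        (w₀.1.adicCompletion (CyclotomicField (cycLevel p k r) ℚ)) (tateRep W p).toIntRep.toTopRep
        (cycSubgroup p k r) hU 1
        (((tateRep W p).level (cycSubgroup p k r)).H1toInt
          (conjMap (tateRep W p).toTopRep (cycSubgroup p k r) (g w) 1 y)))))
    (y : H1 (tateRep W p) (cycSubgroup p k r))
    (hy : ∀ v : HeightOneSpectrum (𝓞 ℚ), ((Rat.HeightOneSpectrum.primesEquiv v : Nat.Primes) : ℕ) = p →
      ∀ 𝔓 ∈ v.primesAbove, resLe (tateRep W p).toTopRep
        (inf_le_left : cycSubgroup p k r ⊓ MulAction.stabilizer (absoluteGaloisGroup ℚ) 𝔓 ≤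
          cycSubgroup p k r) 1 y = 0) :
    Λ y = 0 := by
  apply Ψ.injective
  funext w
  have hv : ((Rat.HeightOneSpectrum.primesEquiv
      ((Rat.HeightOneSpectrum.primesEquiv (R := 𝓞 ℚ)).symm ⟨p, Fact.out⟩) : Nat.Primes) : ℕ) = p := by
    rw [Equiv.apply_symm_apply]
  rw [map_zero, Pi.zero_apply, hdef w y,
    locTower_H1toInt_conjMap_eq_zero_of_forall_primesAbove W p k r _ _ hU y (hy _ hv) (g w),
    map_zero, map_zero]

end Summit.BirchSwinnertonDyer.BirchSwinnertonDyer.Theorems.KimAtThreeFineKatoValueEquivariance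

end
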